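import Mathlib

/-!
# Infinitely many characters from separation of points

Kernel annex of sub-claim B5 (single-level positivity + level), file 6. This file kernel-checks the
deduction used in Remark B5.9 of the owner section `route/T4-B5-p8.md` (the proviso of m-fold
positivity: the compact abelian group `Q = E^1\(A_E^∞)^1` admits infinitely many automorphic
characters) — in a form SIMPLER than the prose of v6: an INFINITE set whose points are separated by
a FINITE group of characters with values in the units of a domain cannot exist, because a finite
character group has exponent `N = |D|`, so all its values lie in the finite set of `N`-th roots of
unity, and separation of points then embeds the set into a finite product of finite sets.

This replaces the two unlocated standard facts of the v6 deduction («no small subgroups in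
`(S¹)^r`»; «open-subgroup basis in a compact totally disconnected group», GAPS (R5)) by: the
continuous characters form a group (pointwise) and separate points (the printed E21,
Dikranjan–Stoyanov 2011 Cor. 5.3). Nothing about adèles or automorphic forms is asserted.

* `finite_of_finite_separating` — the general form: `D` a finite group, `ev : D →* (X → M)` an
  evaluation homomorphism into `M`-valued functions on a type `X`, `ι : M →* Lˣ` injective into the
  units of a domain; if the functions `ev d` separate the points of `X`, then `X` is finite.
* `finite_of_finite_subgroup_separating` — for a finite subgroup `S` of characters `G →* Lˣ`.
* `infinite_of_subgroup_separating` — the contrapositive used by the prose: an infinite group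
  whose points are separated by a subgroup of characters has infinitely many of them.
* `finite_of_finite_pontryaginDual_separating`, `infinite_pontryaginDual_of_separating` — the same
  for the Pontryagin dual `A →ₜ* Circle` (Mathlib's `PontryaginDual`) of a topological group `A`:
  if its continuous characters separate points (E21 for compact abelian `A`) and `A` is infinite,
  then `PontryaginDual A` is infinite.
-/

namespace Summit.Ventures.HodgeRepro2.LevelPositivity

section General

variable {X M L D : Type*} [CommGroup M] [CommRing L] [IsDomain L] [Group D] [Finite D]

/-- The general separation lemma. `D` is a finite group of «characters» of the type `X`, given
through an evaluation homomorphism `ev : D →* (X → M)` (pointwise multiplication on functions),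
and `M` embeds into the units of a domain `L` via `ι`. If the functions `ev d` separate the points
of `X`, then `X` is finite: with `N = |D|`, every `ev d` has `(ev d)^N = 1`, so every value
`ι (ev d x)` is an `N`-th root of unity, of which a domain has finitely many, and
`x ↦ (d ↦ ι (ev d x))` is an injection of `X` into a finite set. -/
theorem finite_of_finite_separating (ev : D →* (X → M)) (ι : M →* Lˣ) (hι : Function.Injective ι)
    (hsep : ∀ x y : X, x ≠ y → ∃ d : D, ev d x ≠ ev d y) : Finite X := by
  classical
  haveI : NeZero (Nat.card D) := ⟨Nat.card_pos.ne'⟩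
  have hpow : ∀ (d : D) (x : X), ι (ev d x) ^ Nat.card D = 1 := by
    intro d x
    have h : ev (d ^ Nat.card D) x = 1 := by
      rw [pow_card_eq_one', map_one]
      rfl
    rw [map_pow, Pi.pow_apply] at h
    rw [← map_pow, h, map_one]
  let f : X → (D → rootsOfUnity (Nat.card D) L) := fun x d =>
    ⟨ι (ev d x), (mem_rootsOfUnity _ _).2 (hpow d x)⟩
  refine Finite.of_injective f ?_
  intro x y hxy
  by_contra hne
  obtain ⟨d, hd⟩ := hsep x y hne
  apply hd
  apply hι
  exact congrArg (fun h : D → rootsOfUnity (Nat.card D) L =>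
    ((h d : rootsOfUnity (Nat.card D) L) : Lˣ)) hxy

end General

section Characters

variable {G L : Type*} [Group G] [CommRing L]

/-- The evaluation homomorphism of a subgroup of characters: `S →* (G → Lˣ)`, `φ ↦ (g ↦ φ g)`. -/
def evalHom (S : Subgroup (G →* Lˣ)) : S →* (G → Lˣ) where
  toFun φ g := (φ : G →* Lˣ) g
  map_one' := rfl
  map_mul' _ _ := rfl

/-- Evaluation of the evaluation homomorphism. -/
@[simp]
theorem evalHom_apply (S : Subgroup (G →* Lˣ)) (φ : S) (g : G) : evalHom S φ g = (φ : G →* Lˣ) g :=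
  rfl

variable [IsDomain L]

/-- A group whose points are separated by a FINITE subgroup of characters with values in the units
of a domain is finite. -/
theorem finite_of_finite_subgroup_separating (S : Subgroup (G →* Lˣ)) [Finite S]
    (hsep : ∀ g : G, g ≠ 1 → ∃ φ ∈ S, φ g ≠ 1) : Finite G := by
  refine finite_of_finite_separating (evalHom S) (MonoidHom.id Lˣ) Function.injective_id ?_
  intro x y hxy
  have hne : x⁻¹ * y ≠ 1 := fun h => hxy (inv_mul_eq_one.1 h)
  obtain ⟨φ, hφS, hφ⟩ := hsep _ hne
  refine ⟨⟨φ, hφS⟩, ?_⟩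
  intro h
  apply hφ
  rw [map_mul, map_inv]
  simp only [evalHom_apply] at h
  rw [h, inv_mul_cancel]

/-- Remark B5.9's deduction, in its new form: an INFINITE group whose points are separated by a
subgroup `S` of characters with values in the units of a domain has infinitely many such
characters (`S` is infinite). For the prose: `G = Q = E^1\(A_E^∞)^1`, `L = ℂ`, `S` = the
continuous characters, which separate points by E21. -/
theorem infinite_of_subgroup_separating [Infinite G] (S : Subgroup (G →* Lˣ))
    (hsep : ∀ g : G, g ≠ 1 → ∃ φ ∈ S, φ g ≠ 1) : Infinite S := by
  rw [← not_finite_iff_infinite]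
  intro hfin
  haveI : Finite G := finite_of_finite_subgroup_separating S hsep
  exact not_finite G

end Characters

section Pontryagin

variable {A : Type*} [Monoid A] [TopologicalSpace A]

/-- The evaluation homomorphism of the Pontryagin dual: `PontryaginDual A →* (A → Circle)`. -/
noncomputable def pontryaginEvalHom : PontryaginDual A →* (A → Circle) where
  toFun χ a := χ a
  map_one' := rfl
  map_mul' _ _ := rfl

/-- Evaluation of the Pontryagin evaluation homomorphism. -/
@[simp]
theorem pontryaginEvalHom_apply (χ : PontryaginDual A) (a : A) : pontryaginEvalHom χ a = χ a :=
  rfl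

/-- The circle group embeds into the units of `ℂ`. -/
theorem circle_toUnits_injective : Function.Injective Circle.toUnits := by
  intro z w h
  apply Circle.coe_injective
  simpa using congrArg Units.val h

/-- A topological monoid with a FINITE Pontryagin dual that separates its points is finite. -/
theorem finite_of_finite_pontryaginDual_separating [Finite (PontryaginDual A)]
    (hsep : ∀ x y : A, x ≠ y → ∃ χ : PontryaginDual A, χ x ≠ χ y) : Finite A :=
  finite_of_finite_separating pontryaginEvalHom Circle.toUnits circle_toUnits_injective hsep

/-- Remark B5.9's proviso for the Pontryagin dual: an infinite topological monoid whose continuous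
characters separate points (for compact abelian groups: the printed E21) has an infinite
Pontryagin dual, i.e. infinitely many continuous characters. -/
theorem infinite_pontryaginDual_of_separating [Infinite A]
    (hsep : ∀ x y : A, x ≠ y → ∃ χ : PontryaginDual A, χ x ≠ χ y) : Infinite (PontryaginDual A) := by
  rw [← not_finite_iff_infinite]
  intro hfin
  haveI : Finite A := finite_of_finite_pontryaginDual_separating hsep
  exact not_finite A

/-- For a topological GROUP, separation of points by the dual is equivalent to detecting every
non-identity element. -/
theorem pontryaginDual_separating_iff {B : Type*} [Group B] [TopologicalSpace B] :
    (∀ x y : B, x ≠ y → ∃ χ : PontryaginDual B, χ x ≠ χ y) ↔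
      ∀ x : B, x ≠ 1 → ∃ χ : PontryaginDual B, χ x ≠ 1 := by
  constructor
  · intro h x hx
    obtain ⟨χ, hχ⟩ := h x 1 hx
    exact ⟨χ, by rwa [map_one] at hχ⟩
  · intro h x y hxy
    obtain ⟨χ, hχ⟩ := h (x⁻¹ * y) fun h' => hxy (inv_mul_eq_one.1 h')
    refine ⟨χ, fun h' => hχ ?_⟩
    rw [map_mul, map_inv, h', inv_mul_cancel]

end Pontryagin

end Summit.Ventures.HodgeRepro2.LevelPositivity
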